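import Summits.BirchSwinnertonDyer.Rank1Residual.GaloisImage.KolyvaginCongruenceLevel
import Summits.BirchSwinnertonDyer.Rank1Residual.GaloisImage.KolyvaginDerivativeInertiaRamified
import Summits.BirchSwinnertonDyer.Rank1Residual.GaloisImage.CyclotomicLevelPTowerTransversal
import Summits.BirchSwinnertonDyer.Rank1Residual.GaloisImage.TateModuleFrobeniusKolyvagin
import Summits.BirchSwinnertonDyer.Rank1Residual.GaloisImage.KolyvaginDerivativeTate
import Literature.NumberTheory.GaloisRepresentations.InertiaPadicCharacterProofs
import HarnessLib

/-!
# The Kolyvagin congruence for an Euler system of `T_p E` over the cyclotomic levels of `ℚ`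
# (Perrin-Riou, Prop. 2.2.5 (ii), at a Kolyvagin prime) — file C0e of THEOREM C of row T-DER
# (cell `b2b-bsdres`, team n1011, seat p11 GEN 9, OWNERS row T-DER = skel/T-DER.md STATUS v8 (v8-2),
# referee-1 GEN 35 ACK-1 provisos (ii)–(iv), (vii))

HONEST FRAMING (cell `b2b-bsdres`, run/shared/lean/b2b/bsd-rank1-residual/, verbatim in every
file): the goal of the cell is to DELETE the COMBINATION-SHAPED residual classes of the
Birch–Swinnerton-Dyer formula for ALL analytic-rank `≤ 1` elliptic curves over `ℚ` — "full BSD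
formula for every rank `≤ 1` curve in class `C`" assembled STRICTLY from published theorems — so
that the rank-`≤ 1` remainder becomes exactly the CONSTRUCTION-SHAPED classes, which are TYPED
(missing-input `Prop`s), NOT attempted. This is not "finishing BSD". Team n1011: research route on
the CONSTRUCTION-SHAPED class X4 / §I N11 (route-1 PORT, (P-DER)); TOOL theorem: NO Euler system is
asserted to exist (it is the hypothesis `hc`), no definition, no named fact, no `sorry`.

## What

For an elliptic curve `E/ℚ` (globally minimal `W`), an odd prime `p`, the Tate module
`T = T_p E` (`W.tateGaloisRep p`), an Euler system `c` for `T` over `cyclotomicLevelsRat p S`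
(`hc : IsEulerSystem …` — a HYPOTHESIS), a level `r`, a Kolyvagin prime `q ∉ r` of level `k ≥ 1`
(`Kato.IsKolyvaginPrime W p k q′`), a prime `𝔔 ∣ q` of `ℚ̄` and an arithmetic Frobenius `φ` at `𝔔`
fixing `μ_{q′}` (n1011-p15 CK-1a `Rat.exists_isArithFrobAtPlace_mem_tameLevel`), with exponent data
`f, r₀` (`q′^f ≡ 1 (mod ℓ′)` for `ℓ ∈ r`, `r₀ = v_p(q′^f − 1) ≥ 1`: CK-1b `Rat.exists_frobenius_pow_datum`)
and an operator `Z` with `P_q(φ⁻¹) = (q′ − 1) • Z` on `T` commuting with `ρ(φ)` (n1011-p13 K4):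
**the Kolyvagin congruence at the layer `r₀`**,
  `x'(φ^f) − Z x(φ^f) ∈ (ρ(φ^f) − 1) T`  for ALL representatives `x'` of `c_{r₀,rq}`, `x` of `c_{r₀,r}`
(`exists_sub_eq_sub_one_apply_frobenius_pow_level`) — C0d
`Congruence.exists_sub_eq_sub_one_apply_of_eulerSystem` (which consumes `IsEulerSystem.cores_p` at
`rq` and at `r` and `IsEulerSystem.cores_cons`, BY NAME) with EVERY binder discharged from the tree:
the tame transversal inside `I_𝔔` (tree `exists_mem_inertia_modNCyclotomicCharacter_eq`, T-DER-INST
`existsUnique_pow_inv_mul_mem_rootsOfUnityFixer`), the layer transversal of `φ^f` (CK-1b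
`Rat.exists_lt_frobenius_pow_inv_mul_mem_level` / `Rat.eq_of_frobenius_pow_inv_mul_mem_level` —
referee-1 proviso (iv): the layer arithmetic is a separate named lemma), `(ρ(φ)^f)^{pⁿ} − 1`
injective and `(ρ(φ)^f − 1)² T ⊆ pT` (CK-2, from `Kato.IsKolyvaginPrime` — proviso (iii)),
`q′ − 1 = p^{v_p(q′−1)} d` with `d ∈ ℤ_pˣ`, no `p`-torsion (`T_p E` free), the vanishing of
`T`-cocycles on `I_𝔔` at both layer-`(r₀+n)` levels (E1 `apply_eq_zero_of_mem_inertia_of_mem_tate`,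
item (3)), and the decomposition data `D = Stab(𝔔) ⊇ I_𝔔` (Mathlib `IsArithFrobAt.mem_stabilizer`,
tree `conj_mem_inertia_smul`).  The descent to the bottom layer and the transport through `D_r`
(C0d `…_bot`, G3) follow in the next file.  0 defs, 0 facts.

References: B. Perrin-Riou, Ann. Inst. Fourier 48 (1998), Prop. 2.2.5 (ii); K. Rubin, *Euler
Systems* (2000), §4.8; C.-H. Kim, arXiv:2203.12159, §1.2.2 (`𝒫_k`).
-/

noncomputable section

open CategoryTheory Function Finset Polynomial Field IsDedekindDomain
open scoped NumberField Pointwise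
open Literature.NumberTheory.GaloisRepresentations Literature.NumberTheory.EllipticCurves
open Literature.NumberTheory.EllipticCurves (subgroupConj subgroupConj_apply_coe)
open Summit.BirchSwinnertonDyer.Rank1Residual.GaloisImage.CyclotomicLevel
open Rat.HeightOneSpectrum

universe u

namespace Summit.BirchSwinnertonDyer.Rank1Residual.GaloisImage

namespace Congruence

namespace Rat

variable (W : WeierstrassCurve ℚ) [W.IsElliptic] [W.IsGloballyMinimal] (p : ℕ) [Fact p.Prime]

/-! ### §1 Small arithmetic inputs -/

omit [W.IsElliptic] [W.IsGloballyMinimal] in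
/-- `T_p E` has no `p`-torsion (it is a free `ℤ_p`-module). [folklore] -/
theorem eq_zero_of_smul_eq_zero_tateModule [Module.Free ℤ_[p] (W.tateModule p)]
    (t : W.tateModule p) (h : p • t = 0) : t = 0 := by
  rw [← Nat.cast_smul_eq_nsmul ℤ_[p]] at h
  rcases smul_eq_zero.mp h with h0 | h0
  · exact absurd h0 (by exact_mod_cast (Fact.out : p.Prime).ne_zero)
  · exact h0

/-! ### §2 The congruence at the layer `r₀ = v_p(q′^f − 1)` for a Frobenius datum `(𝔔, φ)` -/

section Level

variable {p}
variable [Module.Free ℤ_[p] (W.tateModule p)] [Module.Finite ℤ_[p] (W.tateModule p)]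
  [ContinuousSMul ℤ_[p] (W.tateModule p)]
variable (S : Set (HeightOneSpectrum (𝓞 ℚ)))

/-- **The Kolyvagin congruence at the layer `r₀` for `T_p E` over `cyclotomicLevelsRat p S`**
([PerrinRiou98] Prop. 2.2.5 (ii) for Kato-type Euler systems; see the module docstring).  Binders:
the Euler system `hc` (a hypothesis), the Kolyvagin prime `hKol`, the Frobenius datum
`h𝔔, hφ, hφq, hf, hft, hfp, hr₀` (exists: CK-1b `Rat.exists_frobenius_pow_datum`), the membership
`hφ₀` (CK-1b `Rat.frobenius_pow_mem_level`), and the operator `Z` with `hZc`, `hZ` (K4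
`Rat.aeval_galoisRepTate_inv_rubinEulerFactor_apply`).  Conclusion for ALL representatives.
[cite: PerrinRiou1998AIF, Prop. 2.2.5 (ii)] -/
theorem exists_sub_eq_sub_one_apply_frobenius_pow_level (hp2 : p ≠ 2)
    {c : ∀ (i : ℕ) (r : (cyclotomicLevelsRat p S).Ideals),
      H1 (W.tateGaloisRep p (W.continuous_galoisRepTate_holds p)) ((cyclotomicLevelsRat p S).level i r.1)}
    (hc : IsEulerSystem (cyclotomicLevelsRat p S)
      (W.tateGaloisRep p (W.continuous_galoisRepTate_holds p)) p c)
    {k : ℕ} (hk : 0 < k) (r : (cyclotomicLevelsRat p S).Ideals) {q : HeightOneSpectrum (𝓞 ℚ)}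
    (hq : q ∈ (cyclotomicLevelsRat p S).primes) (hqr : q ∉ r.1)
    (hKol : Kato.IsKolyvaginPrime W p k ((primesEquiv q : Nat.Primes) : ℕ))
    {𝔔 : Ideal (absIntegers (𝓞 ℚ) ℚ)} (h𝔔 : 𝔔 ∈ q.primesAbove)
    {φ : absoluteGaloisGroup ℚ} (hφ : IsArithFrobAt (𝓞 ℚ) φ 𝔔)
    (hφq : φ ∈ (cyclotomicLevelsRat p S).tameLevel q)
    {f r₀ : ℕ} (hf : f ≠ 0)
    (hft : ∀ ℓ ∈ r.1, ((primesEquiv q : Nat.Primes) : ℕ) ^ f ≡ 1 [MOD ((primesEquiv ℓ : Nat.Primes) : ℕ)])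
    (hfp : p ∣ ((primesEquiv q : Nat.Primes) : ℕ) ^ f - 1)
    (hr₀ : padicValNat p (((primesEquiv q : Nat.Primes) : ℕ) ^ f - 1) = r₀)
    (hφ₀ : φ ^ f ∈ (cyclotomicLevelsRat p S).level r₀ (r.cons q hq).1)
    (Z : W.tateModule p →ₗ[ℤ_[p]] W.tateModule p) (hZc : Commute (W.galoisRepTate p φ) Z)
    (hZ : ∀ t : W.tateModule p,
      aeval (W.galoisRepTate p φ⁻¹)
        (rubinEulerFactor (W.galoisRepTate p) (cyclotomicCharacterToUnits ℚ p ℤ_[p]) φ) t =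
      ((((primesEquiv q : Nat.Primes) : ℕ) - 1 : ℕ) : ℤ_[p]) • Z t)
    (xr' : contOneCocycles (subgroupRep (W.tateGaloisRep p (W.continuous_galoisRepTate_holds p)).toTopRep
      ((cyclotomicLevelsRat p S).level r₀ (r.cons q hq).1)))
    (hxr' : oneCocycleClass _ xr' = c r₀ (r.cons q hq))
    (xr : contOneCocycles (subgroupRep (W.tateGaloisRep p (W.continuous_galoisRepTate_holds p)).toTopRep
      ((cyclotomicLevelsRat p S).level r₀ r.1)))
    (hxr : oneCocycleClass _ xr = c r₀ r) :
    ∃ w : W.tateModule p, xr'.1 ⟨φ ^ f, hφ₀⟩ -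
        Z (xr.1 ⟨φ ^ f, (cyclotomicLevelsRat p S).level_insert_le r₀ r.1 q hφ₀⟩) =
      W.galoisRepTate p (φ ^ f) w - w := by
  classical
  -- notation and elementary facts about `q`
  set q' : ℕ := ((primesEquiv q : Nat.Primes) : ℕ) with hq'
  have hq'p : q'.Prime := (primesEquiv q).2
  haveI : Fact q'.Prime := ⟨hq'p⟩
  haveI : NeZero q' := ⟨hq'p.ne_zero⟩
  have hne : q' ≠ p := hKol.ne
  have h2 : q' ≠ 2 := Derivative.Rat.ne_two_of_isKolyvaginPrime W p hk hKol
  have hgood : W.HasGoodReductionAt q := CyclotomicLevel.Rat.hasGoodReductionAt_of_isKolyvaginPrime W hKol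
  have hpv : ((p : ℕ) : 𝓞 ℚ) ∉ q.asIdeal :=
    Rat.natCast_not_mem_asIdeal_of_not_dvd fun h =>
      hne ((Nat.prime_dvd_prime_iff_eq hq'p (Fact.out : p.Prime)).mp h)
  have hφP : IsArithFrobAtPlace ℚ q φ := ⟨𝔔, h𝔔, hφ⟩
  haveI := h𝔔.1
  -- the fixer lemma: inertia at `𝔔 ∣ q` fixes `μ_m` for `q′ ∤ m`
  have hfix : ∀ {τ : absoluteGaloisGroup ℚ}, τ ∈ 𝔔.inertia (absoluteGaloisGroup ℚ) →
      ∀ m : ℕ, m ≠ 0 → ¬ q' ∣ m → τ ∈ rootsOfUnityFixer ℚ m := by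
    intro τ hτ m hm0 hqm
    haveI : NeZero m := ⟨hm0⟩
    exact rootsOfUnityFixer_unramifiedAt_of_not_mem ℚ m (Rat.natCast_not_mem_asIdeal_of_not_dvd hqm)
      𝔔 h𝔔 hτ
  have hqℓ : ∀ ℓ ∈ r.1, ¬ q' ∣ ((primesEquiv ℓ : Nat.Primes) : ℕ) := fun ℓ hℓ h =>
    hqr ((primesEquiv.injective (Subtype.ext
      ((Nat.prime_dvd_prime_iff_eq hq'p (primesEquiv ℓ).2).mp h))) ▸ hℓ)
  have hqp : ∀ i : ℕ, ¬ q' ∣ p ^ i := fun i h =>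
    hne ((Nat.prime_dvd_prime_iff_eq hq'p (Fact.out : p.Prime)).mp (hq'p.dvd_of_dvd_pow h))
  have hmemI : ∀ {τ : absoluteGaloisGroup ℚ}, τ ∈ 𝔔.inertia (absoluteGaloisGroup ℚ) →
      ∀ (i : ℕ) (t : Finset (HeightOneSpectrum (𝓞 ℚ))), (∀ ℓ ∈ t, ℓ ≠ q) → τ ∈ (cyclotomicLevelsRat p S).level i t := by
    intro τ hτ i t ht
    refine (cyclotomicLevelsRat p S).mem_level_iff.mpr ⟨?_, fun ℓ hℓ => ?_⟩
    · rw [CyclotomicLevel.Rat.cyclotomicLevelsRat_pLevel p S]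
      exact hfix hτ _ (pow_ne_zero i (Fact.out : p.Prime).ne_zero) (hqp i)
    · rw [CyclotomicLevel.Rat.cyclotomicLevelsRat_tameLevel p S]
      refine hfix hτ _ (primesEquiv ℓ).2.ne_zero fun h => ht ℓ hℓ ?_
      exact primesEquiv.injective (Subtype.ext ((Nat.prime_dvd_prime_iff_eq hq'p (primesEquiv ℓ).2).mp h)).symm
  have hrq : ∀ ℓ ∈ r.1, ℓ ≠ q := fun ℓ hℓ h => hqr (h ▸ hℓ)
  -- layers `i₀ = r₀ ≤ i₂ = r₀ + n` with `n = r₀`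
  have hq1 : q' - 1 ≠ 0 := Nat.sub_ne_zero_of_lt hq'p.one_lt
  -- (a) the tame generator `σ ∈ I_𝔔` with `χ_{q′}(σ)` a generator of `(ℤ/q′)ˣ`
  obtain ⟨g, hg⟩ := IsCyclic.exists_generator (α := (ZMod q')ˣ)
  have hm : q' = q' ^ (0 + 1) * 1 := by rw [zero_add, pow_one, mul_one]
  obtain ⟨σ, hσI, hσχ⟩ := exists_mem_inertia_modNCyclotomicCharacter_eq (v := q) hm hq'p.not_dvd_one
    rfl h𝔔 (a := g) (Subsingleton.elim _ _)
  have hgen : ∀ x : (ZMod q')ˣ, x ∈ Subgroup.zpowers (modNCyclotomicCharacter ℚ q' σ) := by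
    rw [hσχ]; exact hg
  have hσ₂ : σ ∈ (cyclotomicLevelsRat p S).level (r₀ + r₀) r.1 := hmemI hσI _ _ hrq
  have hcard : Nat.card (ZMod q')ˣ = q' - 1 := CyclotomicLevel.Rat.natCard_units_zmod_eq_sub_one hq'p
  have htame : (cyclotomicLevelsRat p S).tameLevel q = rootsOfUnityFixer ℚ q' := by rw [CyclotomicLevel.Rat.cyclotomicLevelsRat_tameLevel p S]
  have hcovσ : ∀ g ∈ (cyclotomicLevelsRat p S).level (r₀ + r₀) r.1, ∃ j < q' - 1,
      (σ ^ j)⁻¹ * g ∈ (cyclotomicLevelsRat p S).level (r₀ + r₀) (r.cons q hq).1 := by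
    intro g hg'
    obtain ⟨j, ⟨hj, hjg⟩, -⟩ := CyclotomicLevel.Rat.existsUnique_pow_inv_mul_mem_rootsOfUnityFixer σ hgen g
    refine ⟨j, hcard ▸ hj, ?_⟩
    have hmem : (σ ^ j)⁻¹ * g ∈ (cyclotomicLevelsRat p S).level (r₀ + r₀) r.1 :=
      Subgroup.mul_mem _ (Subgroup.inv_mem _ (Subgroup.pow_mem _ hσ₂ j)) hg'
    rw [(cyclotomicLevelsRat p S).mem_level_iff] at hmem
    change (σ ^ j)⁻¹ * g ∈ (cyclotomicLevelsRat p S).level (r₀ + r₀) (insert q r.1)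
    refine (cyclotomicLevelsRat p S).mem_level_iff.mpr ⟨hmem.1, fun ℓ hℓ => ?_⟩
    rcases Finset.mem_insert.mp hℓ with rfl | hℓ
    · rw [htame]; exact hjg
    · exact hmem.2 ℓ hℓ
  have hinjσ : ∀ j₁ < q' - 1, ∀ j₂ < q' - 1,
      (σ ^ j₁)⁻¹ * σ ^ j₂ ∈ (cyclotomicLevelsRat p S).level (r₀ + r₀) (r.cons q hq).1 → j₁ = j₂ := by
    intro j₁ hj₁ j₂ hj₂ h
    change (σ ^ j₁)⁻¹ * σ ^ j₂ ∈ (cyclotomicLevelsRat p S).level (r₀ + r₀) (insert q r.1) at h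
    rw [(cyclotomicLevelsRat p S).mem_level_iff] at h
    have h₁ : (σ ^ j₁)⁻¹ * σ ^ j₂ ∈ rootsOfUnityFixer ℚ q' := htame ▸ h.2 q (Finset.mem_insert_self q _)
    have h₂ : (σ ^ j₂)⁻¹ * σ ^ j₂ ∈ rootsOfUnityFixer ℚ q' := by rw [inv_mul_cancel]; exact one_mem _
    rw [← hcard] at hj₁ hj₂
    exact (CyclotomicLevel.Rat.existsUnique_pow_inv_mul_mem_rootsOfUnityFixer σ hgen (σ ^ j₂)).unique ⟨hj₁, h₁⟩ ⟨hj₂, h₂⟩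
  have hσT : ∀ t : W.tateModule p, (W.tateGaloisRep p (W.continuous_galoisRepTate_holds p)).toTopRep.ρ σ t = t := fun t => by
    have h := W.galoisRepTate_eq_one_of_mem_inertia p hgood hpv h𝔔 hσI
    change W.galoisRepTate p σ t = t
    rw [h]; rfl
  -- (b) the layer transversal of `φ^f` (CK-1b), `q` inert
  have hft' : ∀ ℓ ∈ (r.cons q hq).1, ℓ ≠ q →
      ((primesEquiv q : Nat.Primes) : ℕ) ^ f ≡ 1 [MOD ((primesEquiv ℓ : Nat.Primes) : ℕ)] := by
    intro ℓ hℓ hℓq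
    change ℓ ∈ insert q r.1 at hℓ
    rcases Finset.mem_insert.mp hℓ with rfl | hℓ
    · exact absurd rfl hℓq
    · exact hft ℓ hℓ
  have hft'' : ∀ ℓ ∈ r.1, ℓ ≠ q →
      ((primesEquiv q : Nat.Primes) : ℕ) ^ f ≡ 1 [MOD ((primesEquiv ℓ : Nat.Primes) : ℕ)] :=
    fun ℓ hℓ _ => hft ℓ hℓ
  have hφM : (φ ^ f) ^ p ^ r₀ ∈ (cyclotomicLevelsRat p S).level (r₀ + r₀) (r.cons q hq).1 :=
    CyclotomicLevel.Rat.frobenius_pow_pow_mem_level hp2 hq hφP hφq _ hf hft' hfp hr₀ r₀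
  have hcovφ' : ∀ g ∈ (cyclotomicLevelsRat p S).level r₀ (r.cons q hq).1, ∃ j < p ^ r₀,
      ((φ ^ f) ^ j)⁻¹ * g ∈ (cyclotomicLevelsRat p S).level (r₀ + r₀) (r.cons q hq).1 := fun g hg' =>
    CyclotomicLevel.Rat.exists_lt_frobenius_pow_inv_mul_mem_level hp2 hq hφP hφq _ hf hft' hfp hr₀ r₀ hg'
  have hinjφ' : ∀ j₁ < p ^ r₀, ∀ j₂ < p ^ r₀,
      ((φ ^ f) ^ j₁)⁻¹ * (φ ^ f) ^ j₂ ∈ (cyclotomicLevelsRat p S).level (r₀ + r₀) (r.cons q hq).1 → j₁ = j₂ :=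
    fun j₁ hj₁ j₂ hj₂ h => CyclotomicLevel.Rat.eq_of_frobenius_pow_inv_mul_mem_level hp2 hq hφP _ hf hfp hr₀ r₀ hj₁ hj₂ h
  have hcovφ : ∀ g ∈ (cyclotomicLevelsRat p S).level r₀ r.1, ∃ j < p ^ r₀, ((φ ^ f) ^ j)⁻¹ * g ∈ (cyclotomicLevelsRat p S).level (r₀ + r₀) r.1 :=
    fun g hg' => CyclotomicLevel.Rat.exists_lt_frobenius_pow_inv_mul_mem_level hp2 hq hφP hφq _ hf hft'' hfp hr₀ r₀ hg'
  have hinjφ : ∀ j₁ < p ^ r₀, ∀ j₂ < p ^ r₀,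
      ((φ ^ f) ^ j₁)⁻¹ * (φ ^ f) ^ j₂ ∈ (cyclotomicLevelsRat p S).level (r₀ + r₀) r.1 → j₁ = j₂ :=
    fun j₁ hj₁ j₂ hj₂ h => CyclotomicLevel.Rat.eq_of_frobenius_pow_inv_mul_mem_level hp2 hq hφP _ hf hfp hr₀ r₀ hj₁ hj₂ h
  -- (c) Frobenius on `T_pE`: injectivity (Weil) and the room `(F^f − 1)² T ⊆ pT` (CK-2)
  have hinjM : Function.Injective fun t : W.tateModule p => (W.tateGaloisRep p (W.continuous_galoisRepTate_holds p)).toTopRep.ρ ((φ ^ f) ^ p ^ r₀) t - t := by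
    have h := Derivative.injective_galoisRepTate_pow_sub_one W p hpv hgood h𝔔 hφ
      (m := f * p ^ r₀) (Nat.mul_pos (Nat.pos_of_ne_zero hf) (pow_pos (Fact.out : p.Prime).pos r₀))
    rw [pow_mul] at h
    exact h
  have hroom : ∀ t : W.tateModule p, ∃ s : W.tateModule p,
      ((W.tateGaloisRep p (W.continuous_galoisRepTate_holds p)) (φ ^ f) - 1) (((W.tateGaloisRep p (W.continuous_galoisRepTate_holds p)) (φ ^ f) - 1) t) = p • s := fun t => by
    have h := CyclotomicLevel.Rat.exists_pow_sub_one_pow_sub_one_eq_galoisRepTate_of_isKolyvaginPrime W p hk hKol hφP f t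
    have e : (W.tateGaloisRep p (W.continuous_galoisRepTate_holds p)) (φ ^ f) = W.galoisRepTate p φ ^ f := by
      rw [map_pow]; rfl
    rw [e]; exact h
  -- (d) `q′ − 1 = p^{r₁} d`, `d ∈ ℤ_pˣ`, `r₁ ≤ n`
  set r₁ : ℕ := (q' - 1).factorization p with hr₁
  set d : ℕ := ordCompl[p] (q' - 1) with hdd
  have hN : q' - 1 = p ^ r₁ * d := (Nat.ordProj_mul_ordCompl_eq_self (q' - 1) p).symm
  have hr₁n : r₁ ≤ r₀ := by
    rw [hr₁, Nat.factorization_def _ (Fact.out : p.Prime), ← hr₀]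
    have hdvd : q' - 1 ∣ q' ^ f - 1 := Nat.sub_one_dvd_pow_sub_one q' f
    exact (padicValNat_dvd_iff_le (Nat.sub_ne_zero_of_lt
      (CyclotomicLevel.Rat.one_lt_primesEquiv_pow q hf))).mp
      (pow_padicValNat_dvd.trans hdvd)
  have hdu : IsUnit (d : ℤ_[p]) :=
    PadicCharacter.isUnit_natCast_of_not_dvd (Nat.not_dvd_ordCompl (Fact.out : p.Prime) hq1)
  have hd : ∀ t : W.tateModule p, d • (↑hdu.unit⁻¹ : ℤ_[p]) • t = t := fun t => by
    rw [← Nat.cast_smul_eq_nsmul ℤ_[p], smul_smul, hdu.mul_val_inv, one_smul]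
  -- (e) the operator `Z`
  have hcomm : Commute ((W.tateGaloisRep p (W.continuous_galoisRepTate_holds p)) (φ ^ f)) Z := by
    have e : (W.tateGaloisRep p (W.continuous_galoisRepTate_holds p)) (φ ^ f) = W.galoisRepTate p φ ^ f := by rw [map_pow]; rfl
    rw [e]; exact hZc.pow_left f
  have hZ' : ∀ t : W.tateModule p,
      ∑ k ∈ range ((rubinEulerFactor (W.tateGaloisRep p (W.continuous_galoisRepTate_holds p)).toRepresentation (cyclotomicCharacterToUnits ℚ p ℤ_[p]) φ).natDegree
        + 1), (rubinEulerFactor (W.tateGaloisRep p (W.continuous_galoisRepTate_holds p)).toRepresentation (cyclotomicCharacterToUnits ℚ p ℤ_[p]) φ).coeff k •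
          (W.tateGaloisRep p (W.continuous_galoisRepTate_holds p)).toTopRep.ρ (φ⁻¹ ^ k) t = (q' - 1) • Z t := fun t => by
    have h := hZ t
    rw [aeval_eq_sum_range, LinearMap.sum_apply, Nat.cast_smul_eq_nsmul] at h
    rw [← h]
    refine sum_congr rfl fun k _ => ?_
    rw [LinearMap.smul_apply, ← map_pow]
    rfl
  -- (f) decomposition data at `𝔔`
  have hID : ∀ g ∈ MulAction.stabilizer (absoluteGaloisGroup ℚ) 𝔔,
      ∀ τ ∈ 𝔔.inertia (absoluteGaloisGroup ℚ), g⁻¹ * τ * g ∈ 𝔔.inertia (absoluteGaloisGroup ℚ) := by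
    intro g hg τ hτ
    have h := conj_mem_inertia_smul hτ g⁻¹
    rw [inv_inv, MulAction.mem_stabilizer_iff.mp (Subgroup.inv_mem _ hg)] at h
    exact h
  have hFrD : φ ∈ MulAction.stabilizer (absoluteGaloisGroup ℚ) 𝔔 := hφ.mem_stabilizer
  have hφD : φ ^ f ∈ MulAction.stabilizer (absoluteGaloisGroup ℚ) 𝔔 := Subgroup.pow_mem _ hFrD f
  have hφFr : (φ ^ f)⁻¹ * φ⁻¹ * φ ^ f * φ ∈ 𝔔.inertia (absoluteGaloisGroup ℚ) := by
    rw [show (φ ^ f)⁻¹ * φ⁻¹ * φ ^ f * φ = 1 by group]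
    exact Subgroup.one_mem _
  have hurI' : ∀ (x : contOneCocycles (subgroupRep (W.tateGaloisRep p (W.continuous_galoisRepTate_holds p)).toTopRep ((cyclotomicLevelsRat p S).level (r₀ + r₀) (r.cons q hq).1)))
      (τ : absoluteGaloisGroup ℚ) (hτI : τ ∈ 𝔔.inertia (absoluteGaloisGroup ℚ))
      (hτ : τ ∈ (cyclotomicLevelsRat p S).level (r₀ + r₀) (r.cons q hq).1), x.1 ⟨τ, hτ⟩ = 0 := fun x τ hτI hτ =>
    Derivative.Inertia.apply_eq_zero_of_mem_inertia_of_mem_tate W p _ ((cyclotomicLevelsRat p S).isOpen_level _ _) hpv hgood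
      x h𝔔 hτI hτ
  have hurI : ∀ (x : contOneCocycles (subgroupRep (W.tateGaloisRep p (W.continuous_galoisRepTate_holds p)).toTopRep ((cyclotomicLevelsRat p S).level (r₀ + r₀) r.1)))
      (τ : absoluteGaloisGroup ℚ) (hτI : τ ∈ 𝔔.inertia (absoluteGaloisGroup ℚ))
      (hτ : τ ∈ (cyclotomicLevelsRat p S).level (r₀ + r₀) r.1), x.1 ⟨τ, hτ⟩ = 0 := fun x τ hτI hτ =>
    Derivative.Inertia.apply_eq_zero_of_mem_inertia_of_mem_tate W p _ ((cyclotomicLevelsRat p S).isOpen_level _ _) hpv hgood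
      x h𝔔 hτI hτ
  -- C0d
  exact exists_sub_eq_sub_one_apply_of_eulerSystem hc hp2 (Nat.le_add_right r₀ r₀) r q hq hqr
    (CyclotomicLevel.Rat.not_subgroupIsUnramifiedAt_cyclotomicLevelsRat_level_insert p S (r₀ + r₀) h2 r.1) φ hφP σ
    (q' - 1) hσ₂ hcovσ hinjσ hσT (φ ^ f) hφ₀ (p ^ r₀) r₀ rfl hφM hcovφ' hinjφ' hcovφ hinjφ hinjM hroom
    (eq_zero_of_smul_eq_zero_tateModule W p) hN hr₁n _ hd Z hcomm hZ' _ _ hID hσI hFrD hφD hφFr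
    hurI' hurI xr' hxr' xr hxr

end Level

end Rat

end Congruence

end Summit.BirchSwinnertonDyer.Rank1Residual.GaloisImage

end
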